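import Literature.MathematicalPhysics.QuantumFieldTheory.Balaban1983to89.B13AccretiveOfRealCoercive
import Literature.MathematicalPhysics.QuantumFieldTheory.Balaban1983to89.B13NodeTorusWalksRungWitness

/-!
# `Balaban1983to89.B13EntrywiseBlockWitness` — A6 JOINT WITNESS of the ENTRYWISE NODE-A BLOCK of the N10 junction
# ([Balaban1988RG2Cluster] Lemmas 1–3 at NODE 00's [B13] group ∕ kernel tower of record, forms 32 ∕ 51C): ONE bond and its
# located copy, a `u`-dependent non-symmetric 2 × 2 fluctuation model `M·1 + u·E₁₂`, the one-cube geodesic decoration, the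
# identity as the (2.5) averaging operator — ALL twenty block binders `hEL … hKmult` hold SIMULTANEOUSLY, non-degenerately

statement-level bookkeeping over published theorems with citation tags; finite-matrix MODELS on a site torus, kernel-checked;
nothing here is a claim about the Yang–Mills mass gap.

Cell `pub-ymgap`, D-0062 Track A (HUMAN RULING D-0149 width push), node N10 = [Balaban1988RG2Cluster] Lemmas 1–3; seat
`pub-ymgap-dag-n10-w2` g0 (width seat 2), item (B) of the n10-c lane's W-SEAT BRIEF (`HOME/pub-ymgap-dag-n10-c/N10-W-SEAT-BRIEF.md`
§3), director-ym №189 STANDING A6 RULE («a theorem whose hypotheses are uninhabited is VACUOUS — inhabit your antecedent»).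

WHY.  The road-of-record junction of N10 — module 32 `Summits/…/BalabanUVNodesN10AtRecord11B13WalksBlockEntrywise.
b13LeafOfRecord_of_located_entrywise` (Stage 3) and its tower edition 51C `…N10B13KernelTowerWalksEntrywise` — reads NODE A's
per-term datum as the ENTRYWISE BLOCK: the fine-bond index `P` located by `locF`; TWO ENTRYWISE LETTERS `hEL : RawEntryLetters
(Δ₀ Z t) (locF Z t) rf.R ρΔ BΔ` of the σ-free fluctuation operator on the complex chart ball ([13] Thm 3.10 (3.108) as a
property of the operator); a fibre bound `hfibF`; the cube decoration `J` with its GEODESIC letter `hGJ`; the (1.11) numerics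
`hηΔ hηε hρε hP2`; the REAL local averaging operator `C` of (2.5) (`hCle hCsupp`); the junction rate and letter match
`hμΔ hμε hμκ hκεΔ hεP hkapP hKP`; the DEFINITION `hKK` of the conditioned operator `KK = Cᵀ·sDecorate(J′, ½raw ⊕ ½rawᵀ)·C`;
ONE positivity `hKacc` at the reference point; `hKfar hKmult`.  This file exhibits ONE set of data meeting every one of
these binders at once, with the `(Z, t)` term index dropped (one term), `rf.R ∕ rf.εP ∕ rf.kapP ∕ rf.KbarP ∕ rf.m₀ ∕ rf.Rσ ∕
rf.nB` and `cp.κ₁` read as free letters (universally quantified where the block allows it: EVERY chart radius `R > 0`,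
EVERY polydisc exponent `κ₁ ≥ 0`, EVERY far-ness `Rσ > 0`, EVERY mass `M > 0`), `(𝒦 Z t).Λ ⊕ (𝒦 Z t).C₀ := Unit ⊕ Unit`
(ONE bond of `Λ` and ONE located copy), `(𝒦 Z t).X := {z}`, `E₃ := ℂ`:
* §1 the MODELS — `loc2 x₀ x₁` (the bond at `x₀`, its copy at `x₁`), `fluct M u := fromBlocks M u 0 M` (`= M·1 + u·E₁₂`,
  `E₁₂` nilpotent: NOT symmetric, so the junction's symmetrization `½raw ⊕ ½rawᵀ` is exercised), `deco` (the ONE-CUBE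
  geodesic decoration `B13EntrywiseWalks.oneCubeDecoration` through `X = {z}`, charging the cube `□₀`), `condOp` (= the
  right-hand side of `hKK` VERBATIM with `C := 1`), `kbarModel` (= the left-hand side of `hKP` verbatim at the model's letters);
* §2 the letters of `fluct` — `rawEntryLetters_fluct` (hEL on every `R`-ball, BY NAME over 56A `B13AccretiveOfRealCoercive.
  rawEntryLetters_of_range_family`: range `d₁(x₀,x₁)`, bound `M + R`), `fluct_not_symm`;
* §3 the decoration — `deco_inl_inr = {□₀}` (a `d₁`-collinear triple `x₀ z x₁` makes the bond–copy entry DECORATED: this is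
  NOT the trivial `J ≡ ∅` of `B13EntrywiseWalks.structuredExpansion_undecorated`), `deco_inl_inl = deco_inr_inr = ∅`, the
  geometric letter BY NAME (`geodesicDecoration_oneCube`, `c₀ = 1`, any `M₁ > 0`);
* §4 the conditioned operator — `condOp_apply` (the Hadamard form, by `sDecorate_symmetrize_rawEntryTerm` +
  `sDecorate_entryTerm_apply`), its four entries (`condOp_inl_inr σ u = σ □₀ · (u∕2)`: GENUINE σ- AND u-DEPENDENCE; both
  off-diagonal entries agree although `fluct` is not symmetric), `condOp_eq_fromBlocks` (closed form), `condOp_zero_zero = M·1`, ★ `condOp_accretive` (hKacc with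
  `m₀ = M`);
* §5 fibres and far-ness of `loc2` (`mF = nB = 1` from `x₀ ≠ x₁`; `hKfar` from `Rσ ≤ d₁(x₀,z), d₁(x₁,z)`);
* §6 ★★ `entrywiseBlock_joint_nonvacuous` — the ∃-PACKAGE whose body is the block's binder TEXT (module 32 :239–271 = n10-c's `N10-W-ITEM-BINDERS.md` (B),
  model substituted) plus the signs `0 < εP ∧ 0 < kapP ∧ 0 < m₀` and three GENUINENESS clauses (a decorated entry exists; the
  conditioned off-diagonal entry is `σ □₀·u∕2`; `Δ₀` is not symmetric), for EVERY site torus carrying a `d₁`-collinear triple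
  with gaps `≥ Rσ`, every cube index `□₀`, every `κ₁ ≥ 0`, `R > 0`, `M > 0`; letters: `(ηΔ, μΔ, εΔ, κΔ, ρΔ) = (1, 1, 4, 3, 7)`,
  `εP = kapP = 1`, `M₁ = 2κ₁ + 1`, `rC = 0`, `mF = c₀ = nB = 1`, `BΔ = (M + R)·e^{7·d₁(x₀,x₁)}`, `KbarP = kbarModel`, `m₀ = M`;
  ★ `entrywiseBlock_joint_nonvacuous_circle` — the closed instance on every circle `ℤ∕nℤ`, `n ≥ 4` (`x₀ z x₁ = 0, 1, 2`, `Rσ = 1`;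
  `B13NodeTorusWalksRungWitness.tdist1_fin1_zero`).
WHAT THIS DOES NOT DO (HONEST LABEL «NODE-A BLOCK ALONE»).  It witnesses the ENTRYWISE NODE-A BLOCK and nothing else: the
Lemma 1–2 located inputs, the reference rung `rf` (witness: `B13NodeTorusWalksRefRungWitness`), the (2.24)–(2.26) numerics
(`B13Bound226Witness{,Centred,Sigma}`, `B13ChainJointNonvacuity`), def-B13's object identities `hKA2 hKG2 hKloc` have their
own witnesses ∕ owners; a single inhabitant of all ≈ 160 binders of form 32 is NOT claimed; the rf-side letters here are NOT
claimed to be those of an admissible `RefPackage`.  NOTHING of Bałaban's `C*Δ_k(σ,𝐔,𝐉)C`, `Δ_k(σ)`, `C` is constructed or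
asserted — whether HIS fluctuation operator has the entrywise letters k-uniformly at complex backgrounds is the in-edge's
([13] = N06) and the NODE 00 pin's content.  Count-neutral Track-A side landing; NOT a discharge of N10; no node count moves;
one finite four-torus programme at fixed ε per run; nothing continuum ∕ ℝ⁴ ∕ OS ∕ mass-gap ∕ Clay.
CITATIONS.  [Balaban1988RG2Cluster] p. 3 (after (1.7): the `s`-decoration), (1.11) p. 5, (2.5)–(2.7) pp. 12–13, p. 15
(«The general case is handled by a perturbative argument»; «For the pair (U, 0) the operators are symmetric»), (2.14)–(2.16)
pp. 15–16; [Balaban1985BackgroundPropagators] (3.93) p. 410, Thm 3.10 (3.107)–(3.108) p. 416; [Balaban1984PropagatorsII]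
(2.46) p. 231, Lemma 2.1 (2.61) p. 234.
0 `sorry`; MODEL `def`s with bodies only (`loc2`, `fluct`, `deco`, `condOp`, `kbarModel`, `circlePt`), no instance, no
notation, no axiom; standard axioms.
-/

noncomputable section

namespace Literature.MathematicalPhysics.QuantumFieldTheory.Balaban1983to89.B13EntrywiseBlockWitness

open Metric Set Finset
open scoped Matrix
open Literature.MathematicalPhysics.QuantumFieldTheory.Balaban1983to89
open Literature.MathematicalPhysics.QuantumFieldTheory.Balaban1983to89.B9Thm37GlueTorus
  (tdist1 tdist1_nonneg tdist1_comm tdist1_self tdist1_triangle tdist1_up_le)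
open Literature.MathematicalPhysics.QuantumFieldTheory.Balaban1983to89.TreeLengthTorus (TPt)
open Literature.MathematicalPhysics.QuantumFieldTheory.Balaban1983to89.B5TorusCover (UT)
open Literature.MathematicalPhysics.QuantumFieldTheory.Balaban1983to89.B5Leibniz121 (up)
open Literature.MathematicalPhysics.QuantumFieldTheory.Balaban1983to89.B13Eq111SDecoupling (sDecorate)
open Literature.MathematicalPhysics.QuantumFieldTheory.Balaban1983to89.B13EntrywiseWalks
  (RawEntryLetters GeodesicDecoration rawEntryTerm entryTerm oneCubeDecoration geodesicDecoration_oneCube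
    sDecorate_entryTerm_apply sDecorate_symmetrize_rawEntryTerm)
open Literature.MathematicalPhysics.QuantumFieldTheory.Balaban1983to89.B13AccretiveOfRealCoercive (rawEntryLetters_of_range_family)
open Literature.MathematicalPhysics.QuantumFieldTheory.Balaban1983to89.B13NodeTorusWalksRungWitness (tdist1_fin1_zero)

variable {ν : ℕ} {Nf : Fin ν → ℕ} [∀ i, NeZero (Nf i)]
variable {d N' : ℕ}

/-! ## §1. The models: one bond and its located copy, the fluctuation model, the one-cube decoration, the conditioned operator -/

/-- MODEL.  The location map of ONE bond (`inl`, at the site `x₀`) and ONE located copy (`inr`, at `x₁`) — the index set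
`Λ ⊕ C₀` of a (2.14)-term's kernels in the smallest case. [cite: Balaban1988RG2Cluster, (2.14) p.15] -/
def loc2 (x₀ x₁ : UT Nf) : Unit ⊕ Unit → UT Nf := Sum.elim (fun _ => x₀) (fun _ => x₁)

/-- MODEL (not Bałaban's operator).  The σ-free FLUCTUATION MODEL on the bond and its copy over the chart `E₃ = ℂ`:
`Δ₀(u) = M·1 + u·E₁₂` — mass `M` on the diagonal, the configuration `u` hopping from the bond into the copy ONLY
(`E₁₂² = 0`; NOT symmetric for `u ≠ 0`). [cite: Balaban1988RG2Cluster, (2.7) p.13, p.15 (toy model, not the paper's operator)] -/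
def fluct (M : ℝ) (u : ℂ) : Matrix (Unit ⊕ Unit) (Unit ⊕ Unit) ℂ :=
  Matrix.fromBlocks (fun _ _ => (M : ℂ)) (fun _ _ => u) (fun _ _ => 0) (fun _ _ => (M : ℂ))

/-- MODEL.  The ONE-CUBE GEODESIC DECORATION of the bond–copy pairs through the σ-region `X = {z}`, charging the cube `□₀`
(`B13EntrywiseWalks.oneCubeDecoration`). [cite: Balaban1988RG2Cluster, p.3 (after (1.7)), (1.11) p.5, p.13] -/
def deco (x₀ x₁ z : UT Nf) (cube : TPt d N') : (Unit ⊕ Unit) × (Unit ⊕ Unit) → Finset (TPt d N') :=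
  oneCubeDecoration (loc2 x₀ x₁) ({z} : Finset (UT Nf)) cube

/-- MODEL.  THE CONDITIONED OPERATOR of the model — the right-hand side of the junction's binder `hKK` VERBATIM
(`Cᵀ·sDecorate(J′, ½raw ⊕ ½rawᵀ)·C`) at `Δ₀ := fluct M`, `J := deco`, `C := 1` (the identity as the (2.5) averaging operator).
[cite: Balaban1988RG2Cluster, p.3 (after (1.7)), (2.5) p.12, p.15] -/
def condOp (x₀ x₁ z : UT Nf) (cube : TPt d N') (M : ℝ) (σ : TPt d N' → ℂ) (u : ℂ) :
    Matrix (Unit ⊕ Unit) (Unit ⊕ Unit) ℂ :=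
  ((1 : Matrix (Unit ⊕ Unit) (Unit ⊕ Unit) ℝ).map (algebraMap ℝ ℂ))ᵀ *
    sDecorate (fun ω : ((Unit ⊕ Unit) × (Unit ⊕ Unit)) ⊕ ((Unit ⊕ Unit) × (Unit ⊕ Unit)) =>
        deco x₀ x₁ z cube (Sum.elim id id ω))
      (fun ω u => Sum.elim (fun ω => (1 / 2 : ℂ) • rawEntryTerm (fluct M) ω u)
        (fun ω => (1 / 2 : ℂ) • (rawEntryTerm (fluct M) ω u)ᵀ) ω) σ u *
    (1 : Matrix (Unit ⊕ Unit) (Unit ⊕ Unit) ℝ).map (algebraMap ℝ ℂ)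

/-- MODEL bookkeeping.  The junction's expansion constant (the left-hand side of `hKP`) at the model's letters
`mF = c₀ = 1`, `μΔ = ηΔ = 1`, `ρΔ = 7`, `rC = 0`, `BΔ = B`. [cite: Balaban1988RG2Cluster, (1.11) p.5, (2.16) p.16] -/
def kbarModel (ν : ℕ) (κ₁ B : ℝ) : ℝ :=
  ((1 : ℕ) * B6.c0 1 (1 : ℝ) ^ ν) * (((1 : ℕ) * B6.c0 1 (1 : ℝ) ^ ν) * Real.exp (((7 : ℝ) - 1) * 0) *
    (Real.exp (κ₁ * (2 * 1 : ℕ)) * (B * ((1 : ℕ) * (1 : ℕ) + 1))) * B6.c0 1 (1 : ℝ) ^ ν) *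
    Real.exp (((7 : ℝ) - 1 - 1) * 0) * B6.c0 1 (1 : ℝ) ^ ν

/-! ## §2. The entrywise letters of the fluctuation model -/

section Fluct

variable (M : ℝ)

/-- The bond–bond entry is the mass. [cite: Balaban1988RG2Cluster, (2.7) p.13 (toy model)] -/
@[simp] theorem fluct_inl_inl (u : ℂ) (a b : Unit) : fluct M u (Sum.inl a) (Sum.inl b) = (M : ℂ) := by
  simp [fluct]

/-- The copy–copy entry is the mass. [cite: Balaban1988RG2Cluster, (2.7) p.13 (toy model)] -/
@[simp] theorem fluct_inr_inr (u : ℂ) (a b : Unit) : fluct M u (Sum.inr a) (Sum.inr b) = (M : ℂ) := by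
  simp [fluct]

/-- The bond–copy entry is the configuration `u`. [cite: Balaban1988RG2Cluster, (2.7) p.13 (toy model)] -/
@[simp] theorem fluct_inl_inr (u : ℂ) (a b : Unit) : fluct M u (Sum.inl a) (Sum.inr b) = u := by
  simp [fluct]

/-- The copy–bond entry vanishes (`E₁₂` is nilpotent). [cite: Balaban1988RG2Cluster, (2.7) p.13 (toy model)] -/
@[simp] theorem fluct_inr_inl (u : ℂ) (a b : Unit) : fluct M u (Sum.inr a) (Sum.inl b) = 0 := by
  simp [fluct]

/-- **GENUINENESS — the fluctuation model is NOT symmetric** off `u = 0` (so the junction's symmetrization is exercised and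
the two entrywise letters are used WITHOUT the symmetry letter of `EntryLetters`). [cite: Balaban1988RG2Cluster, p.15] -/
theorem fluct_not_symm {u : ℂ} (hu : u ≠ 0) :
    fluct M u (Sum.inl ()) (Sum.inr ()) ≠ fluct M u (Sum.inr ()) (Sum.inl ()) := by
  rw [fluct_inl_inr, fluct_inr_inl]; exact hu

/-- Entrywise holomorphy of the fluctuation model (entries constant or the identity). [cite: Balaban1985BackgroundPropagators, Thm 3.10 p.416] -/
theorem differentiableOn_fluct (s : Set ℂ) (i j : Unit ⊕ Unit) : DifferentiableOn ℂ (fun u => fluct M u i j) s := by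
  rcases i with ⟨⟨⟩⟩ | ⟨⟨⟩⟩ <;> rcases j with ⟨⟨⟩⟩ | ⟨⟨⟩⟩
  · simp only [fluct_inl_inl]; exact differentiableOn_const _
  · simp only [fluct_inl_inr]; exact differentiableOn_id
  · simp only [fluct_inr_inl]; exact differentiableOn_const _
  · simp only [fluct_inr_inr]; exact differentiableOn_const _

variable {M}

/-- Entry bound `M + R` on the `R`-ball (`M ≥ 0`). [cite: Balaban1985BackgroundPropagators, (3.108) p.416] -/
theorem norm_fluct_le (hM : 0 ≤ M) {R : ℝ} {u : ℂ} (hu : u ∈ ball (0 : ℂ) R) (i j : Unit ⊕ Unit) :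
    ‖fluct M u i j‖ ≤ M + R := by
  have hu' : ‖u‖ < R := mem_ball_zero_iff.1 hu
  have hR : 0 ≤ R := (norm_nonneg u).trans hu'.le
  have hMn : ‖(M : ℂ)‖ = M := by rw [Complex.norm_real, Real.norm_eq_abs, abs_of_nonneg hM]
  rcases i with ⟨⟨⟩⟩ | ⟨⟨⟩⟩ <;> rcases j with ⟨⟨⟩⟩ | ⟨⟨⟩⟩
  · rw [fluct_inl_inl, hMn]; linarith
  · rw [fluct_inl_inr]; linarith
  · rw [fluct_inr_inl, norm_zero]; linarith
  · rw [fluct_inr_inr, hMn]; linarith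

/-- RANGE `d₁(x₀,x₁)`: a non-zero entry joins locations at distance `≤ d₁(x₀,x₁)`. [cite: Balaban1988RG2Cluster, (2.5) p.12] -/
theorem range_fluct (x₀ x₁ : UT Nf) (u : ℂ) (i j : Unit ⊕ Unit) (_h : fluct M u i j ≠ 0) :
    tdist1 Nf (loc2 x₀ x₁ i) (loc2 x₀ x₁ j) ≤ tdist1 Nf x₀ x₁ := by
  have h0 := tdist1_nonneg (N := Nf) x₀ x₁
  rcases i with ⟨⟨⟩⟩ | ⟨⟨⟩⟩ <;> rcases j with ⟨⟨⟩⟩ | ⟨⟨⟩⟩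
  · simp only [loc2, Sum.elim_inl]; rw [tdist1_self]; exact h0
  · simp only [loc2, Sum.elim_inl, Sum.elim_inr]; exact le_rfl
  · simp only [loc2, Sum.elim_inl, Sum.elim_inr]; rw [tdist1_comm]
  · simp only [loc2, Sum.elim_inr]; rw [tdist1_self]; exact h0

/-- ★ **hEL — THE TWO ENTRYWISE LETTERS OF THE FLUCTUATION MODEL ON EVERY `R`-BALL**, at every rate `ρ ≥ 0`, constant
`(M + R)·e^{ρ·d₁(x₀,x₁)}` — BY NAME over 56A `rawEntryLetters_of_range_family` (range + one bound + holomorphy).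
[cite: Balaban1985BackgroundPropagators, Thm 3.10 (3.107)–(3.108) p.416; Balaban1988RG2Cluster, (2.5) p.12, p.15] -/
theorem rawEntryLetters_fluct (hM : 0 ≤ M) (x₀ x₁ : UT Nf) {R ρ : ℝ} (hR : 0 ≤ R) (hρ : 0 ≤ ρ) :
    RawEntryLetters (fluct M) (loc2 x₀ x₁) R ρ ((M + R) * Real.exp (ρ * tdist1 Nf x₀ x₁)) :=
  rawEntryLetters_of_range_family (fun i j => differentiableOn_fluct M _ i j) hρ (by linarith)
    (fun u _ i j h => range_fluct x₀ x₁ u i j h) (fun u hu i j => norm_fluct_le hM hu i j)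

end Fluct

/-! ## §3. The one-cube decoration at a collinear triple: decorated off the diagonal, undecorated on it -/

section Deco

variable {x₀ x₁ z : UT Nf} (cube : TPt d N') {Rσ : ℝ}

/-- **GENUINENESS — THE BOND–COPY ENTRY IS DECORATED**: with `z` on a `d₁`-geodesic from `x₀` to `x₁` the entry
`(inl, inr)` is charged the cube `□₀`. [cite: Balaban1988RG2Cluster, p.3 (after (1.7)), p.13] -/
theorem deco_inl_inr (hcol : tdist1 Nf x₀ z + tdist1 Nf z x₁ ≤ tdist1 Nf x₀ x₁) (a b : Unit) :
    deco x₀ x₁ z cube (Sum.inl a, Sum.inr b) = {cube} := by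
  classical
  have h : ∃ z' ∈ ({z} : Finset (UT Nf)), tdist1 Nf (loc2 x₀ x₁ (Sum.inl a)) z' + tdist1 Nf z' (loc2 x₀ x₁ (Sum.inr b))
      ≤ tdist1 Nf (loc2 x₀ x₁ (Sum.inl a)) (loc2 x₀ x₁ (Sum.inr b)) :=
    ⟨z, Finset.mem_singleton_self z, by simpa [loc2] using hcol⟩
  simp only [deco, oneCubeDecoration]
  rw [if_pos h]

/-- … and so is the copy–bond entry (the decoration does not see the orientation). [cite: Balaban1988RG2Cluster, p.13] -/
theorem deco_inr_inl (hcol : tdist1 Nf x₀ z + tdist1 Nf z x₁ ≤ tdist1 Nf x₀ x₁) (a b : Unit) :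
    deco x₀ x₁ z cube (Sum.inr a, Sum.inl b) = {cube} := by
  have hM₁ : (0 : ℝ) < 1 := one_pos
  have hs := (geodesicDecoration_oneCube (d := d) (N' := N') (loc2 x₀ x₁) ({z} : Finset (UT Nf)) cube hM₁).symm
    (Sum.inl b) (Sum.inr a)
  simp only [deco] at *
  rw [hs]
  exact deco_inl_inr cube hcol b a

/-- The bond–bond entry is UNDECORATED when `z ≠ x₀` (`d₁(x₀,z) ≥ Rσ > 0`). [cite: Balaban1988RG2Cluster, (1.11) p.5 («m = 0»)] -/
theorem deco_inl_inl (hRσ : 0 < Rσ) (h0 : Rσ ≤ tdist1 Nf x₀ z) (a b : Unit) :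
    deco x₀ x₁ z cube (Sum.inl a, Sum.inl b) = ∅ := by
  classical
  have h : ¬ ∃ z' ∈ ({z} : Finset (UT Nf)), tdist1 Nf (loc2 x₀ x₁ (Sum.inl a)) z' + tdist1 Nf z' (loc2 x₀ x₁ (Sum.inl b))
      ≤ tdist1 Nf (loc2 x₀ x₁ (Sum.inl a)) (loc2 x₀ x₁ (Sum.inl b)) := by
    rintro ⟨z', hz', hle⟩
    rw [Finset.mem_singleton] at hz'
    subst hz'
    simp only [loc2, Sum.elim_inl] at hle
    rw [tdist1_self, tdist1_comm z' x₀] at hle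
    linarith
  simp only [deco, oneCubeDecoration]
  rw [if_neg h]

/-- The copy–copy entry is UNDECORATED when `z ≠ x₁` (`d₁(x₁,z) ≥ Rσ > 0`). [cite: Balaban1988RG2Cluster, (1.11) p.5 («m = 0»)] -/
theorem deco_inr_inr (hRσ : 0 < Rσ) (h1 : Rσ ≤ tdist1 Nf x₁ z) (a b : Unit) :
    deco x₀ x₁ z cube (Sum.inr a, Sum.inr b) = ∅ := by
  classical
  have h : ¬ ∃ z' ∈ ({z} : Finset (UT Nf)), tdist1 Nf (loc2 x₀ x₁ (Sum.inr a)) z' + tdist1 Nf z' (loc2 x₀ x₁ (Sum.inr b))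
      ≤ tdist1 Nf (loc2 x₀ x₁ (Sum.inr a)) (loc2 x₀ x₁ (Sum.inr b)) := by
    rintro ⟨z', hz', hle⟩
    rw [Finset.mem_singleton] at hz'
    subst hz'
    simp only [loc2, Sum.elim_inr] at hle
    rw [tdist1_self, tdist1_comm z' x₁] at hle
    linarith
  simp only [deco, oneCubeDecoration]
  rw [if_neg h]

/-- hGJ — the one-cube decoration IS a geodesic decoration through `X = {z}` with `c₀ = 1`, any cube side `M₁ > 0`
(`B13EntrywiseWalks.geodesicDecoration_oneCube`, by name). [cite: Balaban1988RG2Cluster, (1.11) p.5, p.13] -/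
theorem geodesicDecoration_deco (x₀ x₁ z : UT Nf) {M₁ : ℝ} (hM₁ : 0 < M₁) :
    GeodesicDecoration (deco x₀ x₁ z cube) (loc2 x₀ x₁) ({z} : Finset (UT Nf)) 1 M₁ :=
  geodesicDecoration_oneCube (loc2 x₀ x₁) {z} cube hM₁

end Deco

/-! ## §4. The conditioned operator: Hadamard form, entries, the reference point, accretivity -/

section CondOp

variable {x₀ x₁ z : UT Nf} (cube : TPt d N') {M Rσ : ℝ}

/-- The identity over `ℝ` maps to the identity over `ℂ` (the real averaging operator read as a complex matrix). [cite: Balaban1988RG2Cluster, (2.5) p.12] -/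
theorem one_map_algebraMap :
    (1 : Matrix (Unit ⊕ Unit) (Unit ⊕ Unit) ℝ).map (algebraMap ℝ ℂ) = 1 :=
  Matrix.map_one _ (map_zero _) (map_one _)

/-- **THE HADAMARD FORM of the model's conditioned operator**: `KK(σ,u)_{ab} = (∏_{□ ∈ J(a,b)} σ(□))·½(Δ₀(u)_{ab} + Δ₀(u)_{ba})`
(`C = 1` drops; `sDecorate_symmetrize_rawEntryTerm` + `sDecorate_entryTerm_apply`). [cite: Balaban1988RG2Cluster, p.3 (after (1.7)), p.15] -/
theorem condOp_apply (x₀ x₁ z : UT Nf) (M : ℝ) (σ : TPt d N' → ℂ) (u : ℂ) (a b : Unit ⊕ Unit) :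
    condOp x₀ x₁ z cube M σ u a b =
      (∏ k ∈ deco x₀ x₁ z cube (a, b), σ k) * ((fluct M u a b + fluct M u b a) / 2) := by
  have hJ : ∀ i j, deco x₀ x₁ z cube (j, i) = deco (d := d) (N' := N') x₀ x₁ z cube (i, j) :=
    (geodesicDecoration_oneCube (loc2 x₀ x₁) ({z} : Finset (UT Nf)) cube one_pos).symm
  rw [condOp, one_map_algebraMap, Matrix.transpose_one, Matrix.one_mul, Matrix.mul_one,
    sDecorate_symmetrize_rawEntryTerm _ hJ, sDecorate_entryTerm_apply]

/-- The bond–bond entry of the conditioned operator is the mass, for every `(σ,u)` (`z ≠ x₀`). [cite: Balaban1988RG2Cluster, (2.7) p.13] -/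
theorem condOp_inl_inl (hRσ : 0 < Rσ) (h0 : Rσ ≤ tdist1 Nf x₀ z) (σ : TPt d N' → ℂ) (u : ℂ) (a b : Unit) :
    condOp x₀ x₁ z cube M σ u (Sum.inl a) (Sum.inl b) = (M : ℂ) := by
  rw [condOp_apply, deco_inl_inl cube hRσ h0, Finset.prod_empty, one_mul, fluct_inl_inl]
  ring

/-- The copy–copy entry of the conditioned operator is the mass, for every `(σ,u)` (`z ≠ x₁`). [cite: Balaban1988RG2Cluster, (2.7) p.13] -/
theorem condOp_inr_inr (hRσ : 0 < Rσ) (h1 : Rσ ≤ tdist1 Nf x₁ z) (σ : TPt d N' → ℂ) (u : ℂ) (a b : Unit) :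
    condOp x₀ x₁ z cube M σ u (Sum.inr a) (Sum.inr b) = (M : ℂ) := by
  rw [condOp_apply, deco_inr_inr cube hRσ h1, Finset.prod_empty, one_mul, fluct_inr_inr]
  ring

/-- ★ **GENUINENESS — THE BOND–COPY ENTRY OF THE CONDITIONED OPERATOR IS `σ(□₀)·u∕2`**: σ-dependent (killed at `σ(□₀) = 0`,
the decoupling of (1.11)) AND u-dependent. [cite: Balaban1988RG2Cluster, p.3 (after (1.7)), (1.11) p.5, (2.5) p.12] -/
theorem condOp_inl_inr (hcol : tdist1 Nf x₀ z + tdist1 Nf z x₁ ≤ tdist1 Nf x₀ x₁) (σ : TPt d N' → ℂ) (u : ℂ)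
    (a b : Unit) :
    condOp x₀ x₁ z cube M σ u (Sum.inl a) (Sum.inr b) = σ cube * (u / 2) := by
  rw [condOp_apply, deco_inl_inr cube hcol, Finset.prod_singleton, fluct_inl_inr, fluct_inr_inl, add_zero]

/-- … and the copy–bond entry is the SAME `σ(□₀)·u∕2` — the conditioned operator is symmetric although `Δ₀(u)` is not
(the symmetrization `½raw ⊕ ½rawᵀ` at work). [cite: Balaban1988RG2Cluster, p.15] -/
theorem condOp_inr_inl (hcol : tdist1 Nf x₀ z + tdist1 Nf z x₁ ≤ tdist1 Nf x₀ x₁) (σ : TPt d N' → ℂ) (u : ℂ)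
    (a b : Unit) :
    condOp x₀ x₁ z cube M σ u (Sum.inr a) (Sum.inl b) = σ cube * (u / 2) := by
  rw [condOp_apply, deco_inr_inl cube hcol, Finset.prod_singleton, fluct_inl_inr, fluct_inr_inl, zero_add]

/-- **CLOSED FORM**: the model's conditioned operator is `fromBlocks M (σ(□₀)u∕2) (σ(□₀)u∕2) M` — symmetric for every
`(σ,u)` although `Δ₀(u)` is not, σ-decorated exactly on the bond–copy entries. [cite: Balaban1988RG2Cluster, p.3 (after (1.7)), p.15] -/
theorem condOp_eq_fromBlocks (hRσ : 0 < Rσ) (h0 : Rσ ≤ tdist1 Nf x₀ z) (h1 : Rσ ≤ tdist1 Nf x₁ z)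
    (hcol : tdist1 Nf x₀ z + tdist1 Nf z x₁ ≤ tdist1 Nf x₀ x₁) (σ : TPt d N' → ℂ) (u : ℂ) :
    condOp x₀ x₁ z cube M σ u =
      Matrix.fromBlocks (fun _ _ => (M : ℂ)) (fun _ _ => σ cube * (u / 2)) (fun _ _ => σ cube * (u / 2))
        (fun _ _ => (M : ℂ)) := by
  ext a b
  rcases a with ⟨⟨⟩⟩ | ⟨⟨⟩⟩ <;> rcases b with ⟨⟨⟩⟩ | ⟨⟨⟩⟩
  · rw [condOp_inl_inl cube hRσ h0, Matrix.fromBlocks_apply₁₁]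
  · rw [condOp_inl_inr cube hcol, Matrix.fromBlocks_apply₁₂]
  · rw [condOp_inr_inl cube hcol, Matrix.fromBlocks_apply₂₁]
  · rw [condOp_inr_inr cube hRσ h1, Matrix.fromBlocks_apply₂₂]

/-- **THE REFERENCE POINT**: at `(σ, u) = (0, 0)` the conditioned operator is `M·1`. [cite: Balaban1988RG2Cluster, p.15 («For the pair (U, 0) the operators are symmetric»)] -/
theorem condOp_zero_zero (hRσ : 0 < Rσ) (h0 : Rσ ≤ tdist1 Nf x₀ z) (h1 : Rσ ≤ tdist1 Nf x₁ z)
    (hcol : tdist1 Nf x₀ z + tdist1 Nf z x₁ ≤ tdist1 Nf x₀ x₁) :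
    condOp x₀ x₁ z cube M 0 0 = (M : ℂ) • (1 : Matrix (Unit ⊕ Unit) (Unit ⊕ Unit) ℂ) := by
  ext a b
  rcases a with ⟨⟨⟩⟩ | ⟨⟨⟩⟩ <;> rcases b with ⟨⟨⟩⟩ | ⟨⟨⟩⟩
  · rw [condOp_inl_inl cube hRσ h0]; simp
  · rw [condOp_inl_inr cube hcol]; simp
  · rw [condOp_inr_inl cube hcol]; simp
  · rw [condOp_inr_inr cube hRσ h1]; simp

/-- ★ **hKacc — ACCRETIVITY AT THE REFERENCE POINT with `m₀ = M`**: `M·Σ‖v_i‖² ≤ Re⟨v, KK(0,0)v⟩` (equality, in fact).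
[cite: Balaban1988RG2Cluster, p.15; Balaban1985BackgroundPropagators, Thm 3.4 p.400] -/
theorem condOp_accretive (hRσ : 0 < Rσ) (h0 : Rσ ≤ tdist1 Nf x₀ z) (h1 : Rσ ≤ tdist1 Nf x₁ z)
    (hcol : tdist1 Nf x₀ z + tdist1 Nf z x₁ ≤ tdist1 Nf x₀ x₁) (v : Unit ⊕ Unit → ℂ) :
    M * ∑ i, ‖v i‖ ^ 2 ≤ (∑ i, star (v i) * (condOp x₀ x₁ z cube M 0 0 *ᵥ v) i).re := by
  rw [condOp_zero_zero cube hRσ h0 h1 hcol]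
  have hterm : ∀ i, star (v i) * ((M : ℂ) * v i) = (M : ℂ) * ((‖v i‖ : ℂ) ^ 2) := by
    intro i
    rw [mul_left_comm, Complex.star_def, Complex.conj_mul']
  have hsum : (∑ i, star (v i) * ((((M : ℂ)) • (1 : Matrix (Unit ⊕ Unit) (Unit ⊕ Unit) ℂ)) *ᵥ v) i) =
      (M : ℂ) * ∑ i, ((‖v i‖ : ℂ) ^ 2) := by
    simp only [Matrix.smul_mulVec, Matrix.one_mulVec, Pi.smul_apply, smul_eq_mul, hterm, Finset.mul_sum]
  rw [hsum]
  have hc : (∑ i, ((‖v i‖ : ℂ) ^ 2)) = ((∑ i, ‖v i‖ ^ 2 : ℝ) : ℂ) := by push_cast; rfl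
  rw [hc, Complex.re_mul_ofReal, Complex.ofReal_re]

/-- hKK — the model's conditioned operator IS the junction's right-hand side at `C := 1` (by definition).
[cite: Balaban1988RG2Cluster, p.3 (after (1.7)), (2.5) p.12] -/
theorem condOp_eq (x₀ x₁ z : UT Nf) (M : ℝ) (σ : TPt d N' → ℂ) (u : ℂ) :
    condOp x₀ x₁ z cube M σ u =
      (((1 : Matrix (Unit ⊕ Unit) (Unit ⊕ Unit) ℝ)).map (algebraMap ℝ ℂ))ᵀ *
        sDecorate (fun ω : ((Unit ⊕ Unit) × (Unit ⊕ Unit)) ⊕ ((Unit ⊕ Unit) × (Unit ⊕ Unit)) =>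
            deco x₀ x₁ z cube (Sum.elim id id ω))
          (fun ω u => Sum.elim (fun ω => (1 / 2 : ℂ) • rawEntryTerm (fluct M) ω u)
            (fun ω => (1 / 2 : ℂ) • (rawEntryTerm (fluct M) ω u)ᵀ) ω) σ u *
        (1 : Matrix (Unit ⊕ Unit) (Unit ⊕ Unit) ℝ).map (algebraMap ℝ ℂ) := rfl

end CondOp

/-! ## §5. Fibres, the averaging operator `C = 1`, far-ness -/

section Fibres

variable {x₀ x₁ z : UT Nf} {Rσ : ℝ}

/-- The bond and its copy sit at DISTINCT sites when `X = {z}` lies between them at positive distance. [cite: Balaban1988RG2Cluster, p.13] -/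
theorem ne_of_collinear (hRσ : 0 < Rσ) (h0 : Rσ ≤ tdist1 Nf x₀ z)
    (hcol : tdist1 Nf x₀ z + tdist1 Nf z x₁ ≤ tdist1 Nf x₀ x₁) : x₀ ≠ x₁ := by
  intro h
  subst h
  rw [tdist1_self] at hcol
  have := tdist1_nonneg (N := Nf) z x₀
  linarith

omit [∀ i, NeZero (Nf i)] in
/-- hfibF ∕ hKmult — the location map `loc2` has fibres of size `≤ 1` (`x₀ ≠ x₁`). [cite: Balaban1988RG2Cluster, (2.16) p.16] -/
theorem fiber_loc2_le_one (hne : x₀ ≠ x₁) (y : UT Nf) :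
    (Finset.univ.filter fun k : Unit ⊕ Unit => loc2 x₀ x₁ k = y).card ≤ 1 := by
  refine Finset.card_le_one.2 fun a ha b hb => ?_
  have ha' := (Finset.mem_filter.1 ha).2
  have hb' := (Finset.mem_filter.1 hb).2
  rcases a with ⟨⟨⟩⟩ | ⟨⟨⟩⟩ <;> rcases b with ⟨⟨⟩⟩ | ⟨⟨⟩⟩
  · rfl
  · simp only [loc2, Sum.elim_inl, Sum.elim_inr] at ha' hb'; exact absurd (ha'.trans hb'.symm) hne
  · simp only [loc2, Sum.elim_inl, Sum.elim_inr] at ha' hb'; exact absurd (hb'.trans ha'.symm) hne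
  · rfl

/-- hCle — the identity has entries of modulus `≤ 1`. [cite: Balaban1988RG2Cluster, (2.5) p.12] -/
theorem abs_one_apply_le (k i : Unit ⊕ Unit) : |(1 : Matrix (Unit ⊕ Unit) (Unit ⊕ Unit) ℝ) k i| ≤ 1 := by
  by_cases h : k = i
  · subst h; simp
  · rw [Matrix.one_apply_ne h, abs_zero]; exact zero_le_one

/-- hCsupp — the identity has RANGE `0`: a non-zero entry joins a location to itself. [cite: Balaban1988RG2Cluster, (2.5) p.12] -/
theorem one_apply_range (k i : Unit ⊕ Unit) (h : (1 : Matrix (Unit ⊕ Unit) (Unit ⊕ Unit) ℝ) k i ≠ 0) :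
    tdist1 Nf (loc2 x₀ x₁ k) (loc2 x₀ x₁ i) ≤ 0 := by
  by_cases hki : k = i
  · subst hki; rw [tdist1_self]
  · exact absurd (Matrix.one_apply_ne hki) h

/-- hKfar — the σ-region `X = {z}` is `Rσ`-far from the bond and from its copy. [cite: Balaban1988RG2Cluster, p.13 («dist(X, Z₀) > ⅔M»)] -/
theorem far_loc2 (h0 : Rσ ≤ tdist1 Nf x₀ z) (h1 : Rσ ≤ tdist1 Nf x₁ z) (k : Unit ⊕ Unit) :
    ∀ z' ∈ ({z} : Finset (UT Nf)), Rσ ≤ tdist1 Nf (loc2 x₀ x₁ k) z' := by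
  intro z' hz'
  rw [Finset.mem_singleton] at hz'
  subst hz'
  rcases k with ⟨⟨⟩⟩ | ⟨⟨⟩⟩
  · simpa [loc2] using h0
  · simpa [loc2] using h1

end Fibres

/-! ## §6. ★★ The joint witness: every binder of the entrywise NODE-A block at once -/

section Joint

/-- `kbarModel ≥ 0` for `B ≥ 0`. [cite: Balaban1988RG2Cluster, (2.16) p.16] -/
theorem kbarModel_nonneg (ν : ℕ) (κ₁ : ℝ) {B : ℝ} (hB : 0 ≤ B) : 0 ≤ kbarModel ν κ₁ B := by
  have hc : 0 ≤ B6.c0 1 (1 : ℝ) ^ ν := pow_nonneg (B6RandomWalk.c0_nonneg 1 1) ν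
  unfold kbarModel
  positivity

/-- ★★ **THE ENTRYWISE NODE-A BLOCK OF THE N10 JUNCTION IS JOINTLY INHABITED, NON-DEGENERATELY** (A6 witness for forms
32 ∕ 51C).  For EVERY site torus `UT Nf` carrying a `d₁`-collinear triple `x₀, z, x₁` with gaps `≥ Rσ > 0`, every cube index
`□₀`, every polydisc exponent `κ₁ ≥ 0` (the junction's `cp.κ₁`), every chart radius `R > 0` (the junction's `rf.R`) and
every mass `M > 0`: there are a fine-bond location map `locF`, a σ-free fluctuation family `Δ₀` on the chart `ℂ`, letters
`(ρΔ, BΔ, εΔ, κΔ, ηΔ, μΔ, M₁, rC, mF, c₀)`, a cube decoration `J`, a real averaging operator `C`, a conditioned operator `KK`,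
a σ-region `X`, a bond location map `locN` and rf-side letters `(εP, kapP, KbarP, m₀, nB)` with `εP, kapP, m₀ > 0` such that
the binders `hKX hEL hfibF hGJ hηΔ hηε hρε hP2 hCle hCsupp hμΔ hμε hμκ hκεΔ hεP hkapP hKP hKK hKacc hKfar hKmult` of
`Summits/…/BalabanUVNodesN10AtRecord11B13WalksBlockEntrywise.b13LeafOfRecord_of_located_entrywise` (TEXT verbatim — n10-c `N10-W-ITEM-BINDERS.md` 62fc2d00e46bb798 — with the
term index `(Z, t)` dropped, `rf.R ↦ R`, `cp.κ₁ ↦ κ₁`, `rf.εP ∕ .kapP ∕ .KbarP ∕ .m₀ ∕ .Rσ ∕ .nB ↦` the letters,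
`(𝒦 Z t).X ↦ X`, `(𝒦 Z t).locN ↦ locN`, `(𝒦 Z t).Λ ⊕ (𝒦 Z t).C₀ ↦ Unit ⊕ Unit`, `E₃ ↦ ℂ`) hold SIMULTANEOUSLY — and
GENUINELY: a decorated entry exists, the conditioned bond–copy entry is `σ(□₀)·u∕2`, `Δ₀` is not symmetric.  The witness:
`locF = locN = loc2 x₀ x₁`, `Δ₀ = fluct M`, `J = deco x₀ x₁ z □₀`, `C = 1`, `KK = condOp x₀ x₁ z □₀ M`, `X = {z}`,
`(ηΔ, μΔ, εΔ, κΔ, ρΔ) = (1, 1, 4, 3, 7)`, `M₁ = 2κ₁ + 1`, `rC = 0`, `mF = c₀ = nB = 1`, `BΔ = (M + R)·e^{7·d₁(x₀,x₁)}`,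
`εP = kapP = 1`, `KbarP = kbarModel ν κ₁ BΔ`, `m₀ = M`.  HONEST LABEL: the NODE-A block ALONE (see the module docstring).
[cite: Balaban1988RG2Cluster, (1.11) p.5, (2.5)–(2.7) pp.12–13, p.15, (2.14)–(2.16) pp.15–16; Balaban1985BackgroundPropagators, (3.93) p.410, Thm 3.10 (3.107)–(3.108) p.416] -/
theorem entrywiseBlock_joint_nonvacuous (cube : TPt d N') {x₀ z x₁ : UT Nf} {Rσ : ℝ} (hRσ : 0 < Rσ)
    (h0 : Rσ ≤ tdist1 Nf x₀ z) (h1 : Rσ ≤ tdist1 Nf x₁ z) (hcol : tdist1 Nf x₀ z + tdist1 Nf z x₁ ≤ tdist1 Nf x₀ x₁)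
    {κ₁ : ℝ} (hκ₁ : 0 ≤ κ₁) {R : ℝ} (hR : 0 < R) {M : ℝ} (hM : 0 < M) :
    ∃ (locF : Unit ⊕ Unit → UT Nf) (Δ₀ : ℂ → Matrix (Unit ⊕ Unit) (Unit ⊕ Unit) ℂ)
      (ρΔ BΔ εΔ κΔ ηΔ μΔ M₁ rC : ℝ) (mF c₀ : ℕ)
      (J : (Unit ⊕ Unit) × (Unit ⊕ Unit) → Finset (TPt d N'))
      (C : Matrix (Unit ⊕ Unit) (Unit ⊕ Unit) ℝ)
      (KK : (TPt d N' → ℂ) → ℂ → Matrix (Unit ⊕ Unit) (Unit ⊕ Unit) ℂ)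
      (X : Finset (UT Nf)) (locN : Unit ⊕ Unit → UT Nf) (εP kapP KbarP m₀ : ℝ) (nB : ℕ),
      -- signs of the rf-side letters (what `rf.Admissible` ∕ `PositiveRates` would demand of them)
      (0 < εP ∧ 0 < kapP ∧ 0 < m₀) ∧
      -- hKX
      X.Nonempty ∧
      -- hEL
      RawEntryLetters Δ₀ locF R ρΔ BΔ ∧
      -- hfibF
      (∀ y : UT Nf, (Finset.univ.filter fun k => locF k = y).card ≤ mF) ∧
      -- hGJ
      GeodesicDecoration J locF X c₀ M₁ ∧
      -- hηΔ hηε hρε hP2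
      0 < ηΔ ∧ ηΔ ≤ εΔ ∧ εΔ < ρΔ ∧ 2 * κ₁ ≤ ηΔ * M₁ ∧
      -- hCle hCsupp
      (∀ k i, |C k i| ≤ 1) ∧ (∀ k i, C k i ≠ 0 → tdist1 Nf (locF k) (locN i) ≤ rC) ∧
      -- hμΔ hμε hμκ hκεΔ
      0 < μΔ ∧ 2 * μΔ ≤ εΔ - ηΔ ∧ 2 * μΔ ≤ κΔ ∧ κΔ ≤ ρΔ - εΔ ∧
      -- hεP hkapP
      εP ≤ εΔ - ηΔ - μΔ - μΔ ∧ kapP ≤ κΔ - μΔ - μΔ ∧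
      -- hKP
      (mF * B6.c0 1 μΔ ^ ν) * ((mF * B6.c0 1 μΔ ^ ν) * Real.exp ((ρΔ - ηΔ) * rC) *
          (Real.exp (κ₁ * (2 * c₀ : ℕ)) * (BΔ * (mF * mF + 1))) * B6.c0 1 μΔ ^ ν) *
          Real.exp ((ρΔ - ηΔ - μΔ) * rC) * B6.c0 1 μΔ ^ ν ≤ KbarP ∧
      -- hKK
      (∀ σ u, KK σ u =
        ((C.map (algebraMap ℝ ℂ))ᵀ *
          sDecorate (fun ω : ((Unit ⊕ Unit) × (Unit ⊕ Unit)) ⊕ ((Unit ⊕ Unit) × (Unit ⊕ Unit)) =>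
              J (Sum.elim id id ω))
            (fun ω u => Sum.elim (fun ω => (1 / 2 : ℂ) • rawEntryTerm Δ₀ ω u)
              (fun ω => (1 / 2 : ℂ) • (rawEntryTerm Δ₀ ω u)ᵀ) ω) σ u *
          C.map (algebraMap ℝ ℂ))) ∧
      -- hKacc
      (∀ v : Unit ⊕ Unit → ℂ, m₀ * ∑ i, ‖v i‖ ^ 2 ≤ (∑ i, star (v i) * (KK 0 0 *ᵥ v) i).re) ∧
      -- hKfar
      (∀ k, ∀ z' ∈ X, Rσ ≤ tdist1 Nf (locN k) z') ∧
      -- hKmult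
      (∀ x : UT Nf, (Finset.univ.filter fun k => locN k = x).card ≤ nB) ∧
      -- GENUINENESS: a decorated entry; the conditioned bond–copy entry is `σ(□₀)·u∕2`; `Δ₀` is not symmetric
      (∃ ω, (J ω).Nonempty) ∧
      (∀ σ u, KK σ u (Sum.inl ()) (Sum.inr ()) = σ cube * (u / 2)) ∧
      (∀ u : ℂ, u ≠ 0 → Δ₀ u (Sum.inl ()) (Sum.inr ()) ≠ Δ₀ u (Sum.inr ()) (Sum.inl ())) := by
  have hne : x₀ ≠ x₁ := ne_of_collinear hRσ h0 hcol
  have hB : 0 ≤ (M + R) * Real.exp (7 * tdist1 Nf x₀ x₁) := by positivity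
  refine ⟨loc2 x₀ x₁, fluct M, 7, (M + R) * Real.exp (7 * tdist1 Nf x₀ x₁), 4, 3, 1, 1, 2 * κ₁ + 1, 0, 1, 1,
    deco x₀ x₁ z cube, 1, condOp x₀ x₁ z cube M, {z}, loc2 x₀ x₁, 1, 1,
    kbarModel ν κ₁ ((M + R) * Real.exp (7 * tdist1 Nf x₀ x₁)), M, 1,
    ⟨one_pos, one_pos, hM⟩, Finset.singleton_nonempty z, rawEntryLetters_fluct hM.le x₀ x₁ hR.le (by norm_num),
    fun y => fiber_loc2_le_one hne y, geodesicDecoration_deco cube x₀ x₁ z (by linarith), one_pos, by norm_num,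
    by norm_num, by nlinarith, abs_one_apply_le, fun k i h => one_apply_range k i h, one_pos, by norm_num, by norm_num,
    by norm_num, by norm_num, by norm_num, ?_, fun σ u => condOp_eq cube x₀ x₁ z M σ u,
    fun v => condOp_accretive cube hRσ h0 h1 hcol v, fun k => far_loc2 h0 h1 k, fun x => fiber_loc2_le_one hne x,
    ⟨(Sum.inl (), Sum.inr ()), ?_⟩, fun σ u => condOp_inl_inr cube hcol σ u () (),
    fun u hu => fluct_not_symm M hu⟩
  · -- hKP: the left-hand side IS `kbarModel` at these letters
    unfold kbarModel
    exact le_rfl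
  · rw [deco_inl_inr cube hcol]; exact Finset.singleton_nonempty _

end Joint

/-! ## §7. The closed instance: the circle `ℤ∕nℤ`, `n ≥ 4`, sites `0, 1, 2` -/

section Circle

/-- MODEL.  The site `k` (`k < n`) of the circle `ℤ∕nℤ` (`ν = 1`). [cite: Balaban1984PropagatorsII, (2.46) p.231] -/
def circlePt (n : ℕ) [NeZero n] (k : ℕ) (hk : k < n) : UT (fun _ : Fin 1 => n) := UT.ofSite _ fun _ => ⟨k, hk⟩

/-- `d₁(0, k) = k` on the circle of size `n ≥ 2k` (`B13NodeTorusWalksRungWitness.tdist1_fin1_zero`, by name).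
[cite: Balaban1984PropagatorsII, (2.46) p.231] -/
theorem tdist1_circlePt_zero (n : ℕ) [NeZero n] {k : ℕ} (hk : k < n) (h2k : 2 * k ≤ n) :
    tdist1 (fun _ : Fin 1 => n) (circlePt n 0 (by omega)) (circlePt n k hk) = k :=
  tdist1_fin1_zero n ⟨k, hk⟩ h2k

/-- `2 = 1 + e₀` on the circle of size `n ≥ 3` (one lattice step). [cite: Balaban1984PropagatorsII, (2.46) p.231] -/
theorem up_circlePt_one (n : ℕ) [NeZero n] (hn : 3 ≤ n) :
    up (circlePt n 1 (by omega)) 0 = circlePt n 2 (by omega) := by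
  simp only [up, circlePt, UT.toSite_ofSite]
  congr 1
  funext i
  rw [Function.update_apply, if_pos (Subsingleton.elim i 0)]
  exact Fin.ext (by simp [Fin.val_add, Nat.mod_eq_of_lt (show 1 + 1 < n by omega)])

/-- `d₁(1, 2) ≤ 1` on the circle of size `n ≥ 3` (one lattice step, `tdist1_up_le`). [cite: Balaban1984PropagatorsII, (2.46) p.231] -/
theorem tdist1_circlePt_one_two_le (n : ℕ) [NeZero n] (hn : 3 ≤ n) :
    tdist1 (fun _ : Fin 1 => n) (circlePt n 1 (by omega)) (circlePt n 2 (by omega)) ≤ 1 := by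
  rw [← up_circlePt_one n hn]
  exact tdist1_up_le _ _

/-- **THE SITES `0, 1, 2` OF THE CIRCLE ARE A `d₁`-COLLINEAR TRIPLE WITH UNIT GAPS** (`n ≥ 4`): `d₁(0,1) ≥ 1`, `d₁(2,1) ≥ 1`,
`d₁(0,1) + d₁(1,2) ≤ d₁(0,2)`. [cite: Balaban1984PropagatorsII, (2.46) p.231] -/
theorem circle_collinear (n : ℕ) [NeZero n] (hn : 4 ≤ n) :
    (1 : ℝ) ≤ tdist1 (fun _ : Fin 1 => n) (circlePt n 0 (by omega)) (circlePt n 1 (by omega)) ∧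
      (1 : ℝ) ≤ tdist1 (fun _ : Fin 1 => n) (circlePt n 2 (by omega)) (circlePt n 1 (by omega)) ∧
      tdist1 (fun _ : Fin 1 => n) (circlePt n 0 (by omega)) (circlePt n 1 (by omega)) +
          tdist1 (fun _ : Fin 1 => n) (circlePt n 1 (by omega)) (circlePt n 2 (by omega))
        ≤ tdist1 (fun _ : Fin 1 => n) (circlePt n 0 (by omega)) (circlePt n 2 (by omega)) := by
  have h01 : tdist1 (fun _ : Fin 1 => n) (circlePt n 0 (by omega)) (circlePt n 1 (by omega)) = (1 : ℕ) :=
    tdist1_circlePt_zero n (by omega) (by omega)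
  have h02 : tdist1 (fun _ : Fin 1 => n) (circlePt n 0 (by omega)) (circlePt n 2 (by omega)) = (2 : ℕ) :=
    tdist1_circlePt_zero n (by omega) (by omega)
  have h12 := tdist1_circlePt_one_two_le n (by omega)
  have htri := tdist1_triangle (N := fun _ : Fin 1 => n) (circlePt n 0 (by omega)) (circlePt n 1 (by omega))
    (circlePt n 2 (by omega))
  rw [Nat.cast_one] at h01
  rw [Nat.cast_ofNat] at h02
  refine ⟨by rw [h01], ?_, by linarith⟩
  rw [tdist1_comm]
  linarith

/-- ★ **THE CLOSED INSTANCE**: on every circle `ℤ∕nℤ` with `n ≥ 4` (sites `x₀ z x₁ = 0, 1, 2`, far-ness `Rσ = 1`), for every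
cube index, `κ₁ ≥ 0`, `R > 0`, `M > 0`, the entrywise NODE-A block is jointly inhabited as in
`entrywiseBlock_joint_nonvacuous`. [cite: Balaban1988RG2Cluster, (1.11) p.5, (2.5)–(2.7) pp.12–13, p.15; Balaban1984PropagatorsII, (2.46) p.231] -/
theorem entrywiseBlock_joint_nonvacuous_circle (n : ℕ) [NeZero n] (hn : 4 ≤ n) (cube : TPt d N')
    {κ₁ : ℝ} (hκ₁ : 0 ≤ κ₁) {R : ℝ} (hR : 0 < R) {M : ℝ} (hM : 0 < M) :
    ∃ (locF : Unit ⊕ Unit → UT (fun _ : Fin 1 => n)) (Δ₀ : ℂ → Matrix (Unit ⊕ Unit) (Unit ⊕ Unit) ℂ)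
      (ρΔ BΔ εΔ κΔ ηΔ μΔ M₁ rC : ℝ) (mF c₀ : ℕ)
      (J : (Unit ⊕ Unit) × (Unit ⊕ Unit) → Finset (TPt d N'))
      (C : Matrix (Unit ⊕ Unit) (Unit ⊕ Unit) ℝ)
      (KK : (TPt d N' → ℂ) → ℂ → Matrix (Unit ⊕ Unit) (Unit ⊕ Unit) ℂ)
      (X : Finset (UT (fun _ : Fin 1 => n))) (locN : Unit ⊕ Unit → UT (fun _ : Fin 1 => n))
      (εP kapP KbarP m₀ : ℝ) (nB : ℕ),
      (0 < εP ∧ 0 < kapP ∧ 0 < m₀) ∧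
      X.Nonempty ∧
      RawEntryLetters Δ₀ locF R ρΔ BΔ ∧
      (∀ y, (Finset.univ.filter fun k => locF k = y).card ≤ mF) ∧
      GeodesicDecoration J locF X c₀ M₁ ∧
      0 < ηΔ ∧ ηΔ ≤ εΔ ∧ εΔ < ρΔ ∧ 2 * κ₁ ≤ ηΔ * M₁ ∧
      (∀ k i, |C k i| ≤ 1) ∧ (∀ k i, C k i ≠ 0 → tdist1 (fun _ : Fin 1 => n) (locF k) (locN i) ≤ rC) ∧
      0 < μΔ ∧ 2 * μΔ ≤ εΔ - ηΔ ∧ 2 * μΔ ≤ κΔ ∧ κΔ ≤ ρΔ - εΔ ∧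
      εP ≤ εΔ - ηΔ - μΔ - μΔ ∧ kapP ≤ κΔ - μΔ - μΔ ∧
      (mF * B6.c0 1 μΔ ^ 1) * ((mF * B6.c0 1 μΔ ^ 1) * Real.exp ((ρΔ - ηΔ) * rC) *
          (Real.exp (κ₁ * (2 * c₀ : ℕ)) * (BΔ * (mF * mF + 1))) * B6.c0 1 μΔ ^ 1) *
          Real.exp ((ρΔ - ηΔ - μΔ) * rC) * B6.c0 1 μΔ ^ 1 ≤ KbarP ∧
      (∀ σ u, KK σ u =
        ((C.map (algebraMap ℝ ℂ))ᵀ *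
          sDecorate (fun ω : ((Unit ⊕ Unit) × (Unit ⊕ Unit)) ⊕ ((Unit ⊕ Unit) × (Unit ⊕ Unit)) =>
              J (Sum.elim id id ω))
            (fun ω u => Sum.elim (fun ω => (1 / 2 : ℂ) • rawEntryTerm Δ₀ ω u)
              (fun ω => (1 / 2 : ℂ) • (rawEntryTerm Δ₀ ω u)ᵀ) ω) σ u *
          C.map (algebraMap ℝ ℂ))) ∧
      (∀ v : Unit ⊕ Unit → ℂ, m₀ * ∑ i, ‖v i‖ ^ 2 ≤ (∑ i, star (v i) * (KK 0 0 *ᵥ v) i).re) ∧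
      (∀ k, ∀ z' ∈ X, (1 : ℝ) ≤ tdist1 (fun _ : Fin 1 => n) (locN k) z') ∧
      (∀ x, (Finset.univ.filter fun k => locN k = x).card ≤ nB) ∧
      (∃ ω, (J ω).Nonempty) ∧
      (∀ σ u, KK σ u (Sum.inl ()) (Sum.inr ()) = σ cube * (u / 2)) ∧
      (∀ u : ℂ, u ≠ 0 → Δ₀ u (Sum.inl ()) (Sum.inr ()) ≠ Δ₀ u (Sum.inr ()) (Sum.inl ())) := by
  obtain ⟨h0, h1, hcol⟩ := circle_collinear n hn
  exact entrywiseBlock_joint_nonvacuous (ν := 1) cube one_pos h0 h1 hcol hκ₁ hR hM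

end Circle

end Literature.MathematicalPhysics.QuantumFieldTheory.Balaban1983to89.B13EntrywiseBlockWitness

end
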